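import Literature.MathematicalPhysics.KineticTheory.SiteChainLyapunovDrift
import HarnessLib

/-!
# Hairer–Mattingly 2009, Prop. 5.1, for site-inhomogeneous Langevin chains: the Cesàro bound and an
# invariant measure from a pointwise Lyapunov function

Topic `Literature/MathematicalPhysics/KineticTheory`, grouping namespace `…KineticTheory.HeatConduction`.
Continuation of `SiteChainLyapunovDrift.lean` (the truncated drift inequality): Fatou removes the
truncation, integration in time gives the Cesàro bound, and the Cesàro Krylov–Bogoliubov theorem gives
Hairer–Mattingly's Prop. 5.1 for every Feller `S : MarkovSemigroupFor ((P : SiteChain).generator N T_L T_R)`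
with Dynkin's identity, in particular for the constructed semigroup / kernels of a uniformly confining
site chain (`SiteChainLangevinKernel.lean`):

* `MarkovSemigroupFor.siteChain_lintegral_lyapunov_add_le` — `∫ 𝒱 dP_t(z,·) + ∫₀ᵗ ∫ W dP_s(z,·) ds ≤ 𝒱(z) + Ct`;
* `MarkovSemigroupFor.siteChain_cesaro_lintegral_le` — `∫_{(0,n+1]} ∫ W dP_s(z,·) ds ≤ (n+1)(𝒱(z)+C)`;
* `MarkovSemigroupFor.siteChain_exists_invariant_of_lyapunov_drift` — Prop. 5.1 (an invariant probability
  measure with `∫ W dμ ≤ 𝒱(z) + C`);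
* `SiteChain.UniformlyConfining.lintegral_lyapunov_add_le`, `.cesaro_lintegral_le_of_generator_le`,
  `.exists_invariant_of_lyapunov_drift` — the same along `P.langevinKernel` / for `hP.semigroup`.

## References

* M. Hairer, J. C. Mattingly, Comm. Pure Appl. Math. **62** (2009) 999–1032, Prop. 5.1 and its proof.
* G. Da Prato, J. Zabczyk, *Ergodicity for infinite-dimensional systems* (1996), Cor. 3.1.2.

## Design choices

* Proofs verbatim from `LangevinChainLyapunovDrift.lean` (the `OscillatorChain` version).
* NOT here: any particular Lyapunov function.
-/

noncomputable section

open MeasureTheory ProbabilityTheory Filter Topology Set Metric Function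
open scoped NNReal ENNReal Topology BoundedContinuousFunction

namespace Literature.MathematicalPhysics.KineticTheory.HeatConduction

open Literature.MathematicalPhysics.KineticTheory Literature.Probability.Process

variable {N : ℕ}

namespace MarkovSemigroupFor

variable {P : SiteChain} {T_L T_R : ℝ} (S : MarkovSemigroupFor (P.generator N T_L T_R))

/-- **The drift inequality (Hairer–Mattingly 2009, proof of Prop. 5.1) for uniformly confining site
chains.** For `N ≥ 1`, `T_L, T_R ≥ 0`, a Markov semigroup `S` with Dynkin's identity on `C²_c` for
`P.generator N T_L T_R`, and a proper `𝒱 ∈ C²`, `𝒱 ≥ 0` with `L𝒱 ≤ C - W` pointwise (`W ≥ 0`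
continuous, `C ≥ 0`): `∫ 𝒱 dP_t(z, ·) + ∫₀ᵗ ∫ W dP_s(z, ·) ds ≤ 𝒱(z) + C t` for all `t ≥ 0`, `z`
(Lebesgue integrals; truncation + Fatou). [cite: HairerMattingly2009, Prop 5.1 (proof)] -/
theorem siteChain_lintegral_lyapunov_add_le (hP : P.UniformlyConfining) (hN : 0 < N)
    (hTL : 0 ≤ T_L) (hTR : 0 ≤ T_R)
    (hdyn : ∀ f : PhaseSpace N → ℝ, ContDiff ℝ 2 f → HasCompactSupport f →
      ∀ (t : ℝ≥0) (z : PhaseSpace N), S.act t f z - f z =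
        ∫ s in (0 : ℝ)..(t : ℝ), S.act s.toNNReal (P.generator N T_L T_R f) z)
    {𝒱 W : PhaseSpace N → ℝ} (h𝒱 : ContDiff ℝ 2 𝒱) (h𝒱0 : ∀ x, 0 ≤ 𝒱 x)
    (h𝒱c : ∀ R : ℝ, IsCompact {x | 𝒱 x ≤ R}) (hW : Continuous W) (hW0 : ∀ x, 0 ≤ W x)
    {C : ℝ} (hC : 0 ≤ C) (hLV : ∀ x, P.generator N T_L T_R 𝒱 x ≤ C - W x)
    (t : ℝ≥0) (z : PhaseSpace N) :
    ∫⁻ y, ENNReal.ofReal (𝒱 y) ∂(S.kernel t z) +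
        ∫⁻ s in Ioc (0 : ℝ) t, ∫⁻ y, ENNReal.ofReal (W y) ∂(S.kernel s.toNNReal z) ≤
      ENNReal.ofReal (𝒱 z + C * t) := by
  have h𝒱cont : Continuous 𝒱 := h𝒱.continuous
  set g : ℕ → PhaseSpace N → ℝ≥0∞ := fun n y =>
    ENNReal.ofReal (((n : ℝ) + 1) * linCutoff (𝒱 y / ((n : ℝ) + 1))) with hgdef
  set w : ℕ → PhaseSpace N → ℝ≥0∞ := fun n y =>
    ENNReal.ofReal (smoothCutoff (𝒱 y / ((n : ℝ) + 1)) * W y) with hwdef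
  have hg_meas : ∀ n, Measurable (g n) := fun n =>
    ENNReal.measurable_ofReal.comp
      (continuous_const.mul (contDiff_two_linCutoff.continuous.comp
        (h𝒱cont.div_const _))).measurable
  have hw_meas : ∀ n, Measurable (w n) := fun n =>
    ENNReal.measurable_ofReal.comp
      ((continuous_smoothCutoff.comp (h𝒱cont.div_const _)).mul hW).measurable
  have hev : ∀ y, ∀ᶠ n : ℕ in atTop, 𝒱 y / ((n : ℝ) + 1) ≤ 1 := fun y => by
    refine (eventually_ge_atTop ⌈𝒱 y⌉₊).mono fun n hn => ?_
    have h1 : 𝒱 y ≤ (n : ℝ) + 1 := by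
      have := Nat.le_ceil (𝒱 y)
      have hn' : (⌈𝒱 y⌉₊ : ℝ) ≤ n := by exact_mod_cast hn
      linarith
    rw [div_le_one (by positivity)]
    exact h1
  have hg_tendsto : ∀ y, Tendsto (fun n => g n y) atTop (𝓝 (ENNReal.ofReal (𝒱 y))) := fun y => by
    refine (tendsto_const_nhds (x := ENNReal.ofReal (𝒱 y))).congr' ?_
    filter_upwards [hev y] with n hn
    simp only [hgdef]
    rw [linCutoff_of_le_one hn, mul_div_cancel₀ _ (by positivity)]
  have hw_tendsto : ∀ y, Tendsto (fun n => w n y) atTop (𝓝 (ENNReal.ofReal (W y))) := fun y => by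
    refine (tendsto_const_nhds (x := ENNReal.ofReal (W y))).congr' ?_
    filter_upwards [hev y] with n hn
    simp only [hwdef]
    rw [smoothCutoff_of_le_one hn, one_mul]
  have hA : ∫⁻ y, ENNReal.ofReal (𝒱 y) ∂(S.kernel t z) ≤
      liminf (fun n => ∫⁻ y, g n y ∂(S.kernel t z)) atTop := by
    calc ∫⁻ y, ENNReal.ofReal (𝒱 y) ∂(S.kernel t z)
        = ∫⁻ y, liminf (fun n => g n y) atTop ∂(S.kernel t z) :=
          lintegral_congr fun y => ((hg_tendsto y).liminf_eq).symm
      _ ≤ liminf (fun n => ∫⁻ y, g n y ∂(S.kernel t z)) atTop := lintegral_liminf_le hg_meas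
  have hΦ_meas : ∀ n, Measurable fun s : ℝ => ∫⁻ y, w n y ∂(S.kernel s.toNNReal z) := fun n =>
    (Measure.measurable_lintegral (hw_meas n)).comp
      (S.measurable_kernel.comp (measurable_real_toNNReal.prodMk measurable_const))
  have hB : ∫⁻ s in Ioc (0 : ℝ) t, ∫⁻ y, ENNReal.ofReal (W y) ∂(S.kernel s.toNNReal z) ≤
      liminf (fun n => ∫⁻ s in Ioc (0 : ℝ) t, ∫⁻ y, w n y ∂(S.kernel s.toNNReal z)) atTop := by
    calc ∫⁻ s in Ioc (0 : ℝ) t, ∫⁻ y, ENNReal.ofReal (W y) ∂(S.kernel s.toNNReal z)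
        ≤ ∫⁻ s in Ioc (0 : ℝ) t, liminf (fun n => ∫⁻ y, w n y ∂(S.kernel s.toNNReal z)) atTop := by
          refine lintegral_mono fun s => ?_
          calc ∫⁻ y, ENNReal.ofReal (W y) ∂(S.kernel s.toNNReal z)
              = ∫⁻ y, liminf (fun n => w n y) atTop ∂(S.kernel s.toNNReal z) :=
                lintegral_congr fun y => ((hw_tendsto y).liminf_eq).symm
            _ ≤ liminf (fun n => ∫⁻ y, w n y ∂(S.kernel s.toNNReal z)) atTop :=
                lintegral_liminf_le hw_meas
      _ ≤ liminf (fun n => ∫⁻ s in Ioc (0 : ℝ) t, ∫⁻ y, w n y ∂(S.kernel s.toNNReal z)) atTop :=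
          lintegral_liminf_le hΦ_meas
  have hkey : ∀ n : ℕ, (∫⁻ y, g n y ∂(S.kernel t z)) +
      ∫⁻ s in Ioc (0 : ℝ) t, ∫⁻ y, w n y ∂(S.kernel s.toNNReal z) ≤ ENNReal.ofReal (𝒱 z + C * t) :=
    fun n => S.siteChain_lintegral_truncLyapunov_add_le hP hN hTL hTR hdyn h𝒱 h𝒱0 h𝒱c hW hW0 hC hLV
      (R := (n : ℝ) + 1) (by positivity) t z
  calc _ ≤ liminf (fun n => ∫⁻ y, g n y ∂(S.kernel t z)) atTop +
        liminf (fun n => ∫⁻ s in Ioc (0 : ℝ) t, ∫⁻ y, w n y ∂(S.kernel s.toNNReal z)) atTop :=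
        add_le_add hA hB
    _ ≤ liminf (fun n => (∫⁻ y, g n y ∂(S.kernel t z)) +
        ∫⁻ s in Ioc (0 : ℝ) t, ∫⁻ y, w n y ∂(S.kernel s.toNNReal z)) atTop :=
        add_liminf_le_liminf_add _ _
    _ ≤ ENNReal.ofReal (𝒱 z + C * t) :=
        liminf_le_of_frequently_le' (Eventually.of_forall hkey).frequently

/-- **The Cesàro bound from the drift inequality**: under the hypotheses of
`siteChain_lintegral_lyapunov_add_le`, `∫_{(0,n+1]} ∫ W dP_s(z,·) ds ≤ (n+1)·(𝒱(z) + C)` for every `n`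
(the shape consumed by `exists_invariant_of_cesaro_bound`). [cite: HairerMattingly2009, Prop 5.1 (proof)] -/
theorem siteChain_cesaro_lintegral_le (hP : P.UniformlyConfining) (hN : 0 < N)
    (hTL : 0 ≤ T_L) (hTR : 0 ≤ T_R)
    (hdyn : ∀ f : PhaseSpace N → ℝ, ContDiff ℝ 2 f → HasCompactSupport f →
      ∀ (t : ℝ≥0) (z : PhaseSpace N), S.act t f z - f z =
        ∫ s in (0 : ℝ)..(t : ℝ), S.act s.toNNReal (P.generator N T_L T_R f) z)
    {𝒱 W : PhaseSpace N → ℝ} (h𝒱 : ContDiff ℝ 2 𝒱) (h𝒱0 : ∀ x, 0 ≤ 𝒱 x)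
    (h𝒱c : ∀ R : ℝ, IsCompact {x | 𝒱 x ≤ R}) (hW : Continuous W) (hW0 : ∀ x, 0 ≤ W x)
    {C : ℝ} (hC : 0 ≤ C) (hLV : ∀ x, P.generator N T_L T_R 𝒱 x ≤ C - W x)
    (z : PhaseSpace N) (n : ℕ) :
    ∫⁻ s in Ioc (0 : ℝ) (n + 1), ∫⁻ y, ENNReal.ofReal (W y) ∂(S.kernel s.toNNReal z) ≤
      ((n : ℝ≥0∞) + 1) * ENNReal.ofReal (𝒱 z + C) := by
  have h := S.siteChain_lintegral_lyapunov_add_le hP hN hTL hTR hdyn h𝒱 h𝒱0 h𝒱c hW hW0 hC hLV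
    ((n : ℝ≥0) + 1) z
  have h1 : (((n : ℝ≥0) + 1 : ℝ≥0) : ℝ) = (n : ℝ) + 1 := by push_cast; ring
  rw [h1] at h
  refine (le_of_add_le_right h).trans ?_
  have h2 : 𝒱 z + C * ((n : ℝ) + 1) ≤ ((n : ℝ) + 1) * (𝒱 z + C) := by
    have : 0 ≤ (n : ℝ) * 𝒱 z := mul_nonneg (Nat.cast_nonneg n) (h𝒱0 z)
    nlinarith
  calc ENNReal.ofReal (𝒱 z + C * ((n : ℝ) + 1))
      ≤ ENNReal.ofReal (((n : ℝ) + 1) * (𝒱 z + C)) := ENNReal.ofReal_le_ofReal h2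
    _ = ((n : ℝ≥0∞) + 1) * ENNReal.ofReal (𝒱 z + C) := by
        rw [ENNReal.ofReal_mul (by positivity)]
        congr 1
        rw [ENNReal.ofReal_add (Nat.cast_nonneg n) zero_le_one, ENNReal.ofReal_natCast,
          ENNReal.ofReal_one]

/-- **Hairer–Mattingly 2009, Proposition 5.1 (drift form) for uniformly confining site chains.** For
`N ≥ 1`, `T_L, T_R ≥ 0`, a FELLER Markov semigroup `S` with Dynkin's identity on `C²_c` for
`P.generator N T_L T_R`, and a proper `𝒱 ∈ C²`, `𝒱 ≥ 0` with `L𝒱 ≤ C - W` for a continuous `W ≥ 0`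
with compact sublevel sets (`C ≥ 0`): there is an invariant probability measure `μ` of `S` with
`∫ W dμ ≤ 𝒱(z) + C`. [cite: HairerMattingly2009, Prop 5.1] -/
theorem siteChain_exists_invariant_of_lyapunov_drift (hP : P.UniformlyConfining) (hN : 0 < N)
    (hTL : 0 ≤ T_L) (hTR : 0 ≤ T_R)
    (hfeller : ∀ (t : ℝ≥0) (g : PhaseSpace N →ᵇ ℝ), Continuous (S.act t g))
    (hdyn : ∀ f : PhaseSpace N → ℝ, ContDiff ℝ 2 f → HasCompactSupport f →
      ∀ (t : ℝ≥0) (z : PhaseSpace N), S.act t f z - f z =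
        ∫ s in (0 : ℝ)..(t : ℝ), S.act s.toNNReal (P.generator N T_L T_R f) z)
    {𝒱 W : PhaseSpace N → ℝ} (h𝒱 : ContDiff ℝ 2 𝒱) (h𝒱0 : ∀ x, 0 ≤ 𝒱 x)
    (h𝒱c : ∀ R : ℝ, IsCompact {x | 𝒱 x ≤ R}) (hW : Continuous W) (hW0 : ∀ x, 0 ≤ W x)
    (hWc : ∀ R : ℝ, IsCompact {x | W x ≤ R})
    {C : ℝ} (hC : 0 ≤ C) (hLV : ∀ x, P.generator N T_L T_R 𝒱 x ≤ C - W x) (z : PhaseSpace N) :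
    ∃ μ : Measure (PhaseSpace N), IsProbabilityMeasure μ ∧ S.IsInvariant μ ∧
      ∫⁻ x, ENNReal.ofReal (W x) ∂μ ≤ ENNReal.ofReal (𝒱 z + C) := by
  set W' : PhaseSpace N → ℝ≥0 := fun x => (W x).toNNReal with hW'def
  have hW'c : Continuous W' := continuous_real_toNNReal.comp hW
  have hW'cpt : ∀ R : ℝ≥0, IsCompact {x | W' x ≤ R} := fun R => by
    have h : {x | W' x ≤ R} = {x | W x ≤ (R : ℝ)} := by
      ext x
      simp only [mem_setOf_eq, hW'def, Real.toNNReal_le_iff_le_coe]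
    rw [h]
    exact hWc R
  have hcoe : ∀ x, (W' x : ℝ≥0∞) = ENNReal.ofReal (W x) := fun x => rfl
  have hC' : ∀ n : ℕ, ∫⁻ s in Ioc (0 : ℝ) (n + 1), ∫⁻ y, (W' y : ℝ≥0∞) ∂(S.kernel s.toNNReal z) ≤
      ((n : ℝ≥0∞) + 1) * ENNReal.ofReal (𝒱 z + C) := fun n => by
    simp only [hcoe]
    exact S.siteChain_cesaro_lintegral_le hP hN hTL hTR hdyn h𝒱 h𝒱0 h𝒱c hW hW0 hC hLV z n
  obtain ⟨μ, hμ, hinv, hb⟩ := MarkovSemigroup.exists_invariant_of_cesaro_bound S.kernel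
    S.kernel_add S.measurable_kernel (fun t g => hfeller t g) W' hW'c hW'cpt
    ENNReal.ofReal_ne_top z hC'
  refine ⟨μ, hμ, hinv, ?_⟩
  simpa only [hcoe] using hb

end MarkovSemigroupFor

/-! ### The constructed semigroups / kernels of uniformly confining site chains -/

namespace SiteChain.UniformlyConfining

variable {P : SiteChain} {T_L T_R : ℝ}

/-- **The drift inequality for the Langevin kernels of a uniformly confining site chain**:
`∫ 𝒱 dP_t(z,·) + ∫₀ᵗ ∫ W dP_s(z,·) ds ≤ 𝒱(z) + C t` along `P.langevinKernel N T_L T_R`.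
[cite: HairerMattingly2009, Prop 5.1 (proof)] -/
theorem lintegral_lyapunov_add_le (hP : P.UniformlyConfining) (hN : 0 < N) (hTL : 0 ≤ T_L)
    (hTR : 0 ≤ T_R) {𝒱 W : PhaseSpace N → ℝ} (h𝒱 : ContDiff ℝ 2 𝒱) (h𝒱0 : ∀ x, 0 ≤ 𝒱 x)
    (h𝒱c : ∀ R : ℝ, IsCompact {x | 𝒱 x ≤ R}) (hW : Continuous W) (hW0 : ∀ x, 0 ≤ W x)
    {C : ℝ} (hC : 0 ≤ C) (hLV : ∀ x, P.generator N T_L T_R 𝒱 x ≤ C - W x) (t : ℝ≥0)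
    (z : PhaseSpace N) :
    ∫⁻ y, ENNReal.ofReal (𝒱 y) ∂(P.langevinKernel N T_L T_R t z) +
        ∫⁻ s in Ioc (0 : ℝ) t, ∫⁻ y, ENNReal.ofReal (W y) ∂(P.langevinKernel N T_L T_R s.toNNReal z) ≤
      ENNReal.ofReal (𝒱 z + C * t) :=
  (hP.semigroup N T_L T_R hN hTL hTR).siteChain_lintegral_lyapunov_add_le hP hN hTL hTR
    (fun _ hf hf' t z => hP.semigroup_dynkin_two N T_L T_R hN hTL hTR hf hf' t z)
    h𝒱 h𝒱0 h𝒱c hW hW0 hC hLV t z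

/-- **The Cesàro bound for the Langevin kernels from a pointwise Lyapunov function**:
`L𝒱 ≤ C - W` gives `∫_{(0,n+1]} ∫ W dP_s(z,·) ds ≤ (n+1)(𝒱(z) + C)` for all `n`.
[cite: HairerMattingly2009, Prop 5.1 (proof)] -/
theorem cesaro_lintegral_le_of_generator_le (hP : P.UniformlyConfining) (hN : 0 < N) (hTL : 0 ≤ T_L)
    (hTR : 0 ≤ T_R) {𝒱 W : PhaseSpace N → ℝ} (h𝒱 : ContDiff ℝ 2 𝒱) (h𝒱0 : ∀ x, 0 ≤ 𝒱 x)
    (h𝒱c : ∀ R : ℝ, IsCompact {x | 𝒱 x ≤ R}) (hW : Continuous W) (hW0 : ∀ x, 0 ≤ W x)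
    {C : ℝ} (hC : 0 ≤ C) (hLV : ∀ x, P.generator N T_L T_R 𝒱 x ≤ C - W x)
    (z : PhaseSpace N) (n : ℕ) :
    ∫⁻ s in Ioc (0 : ℝ) (n + 1), ∫⁻ y, ENNReal.ofReal (W y) ∂(P.langevinKernel N T_L T_R s.toNNReal z) ≤
      ((n : ℝ≥0∞) + 1) * ENNReal.ofReal (𝒱 z + C) :=
  (hP.semigroup N T_L T_R hN hTL hTR).siteChain_cesaro_lintegral_le hP hN hTL hTR
    (fun _ hf hf' t z => hP.semigroup_dynkin_two N T_L T_R hN hTL hTR hf hf' t z)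
    h𝒱 h𝒱0 h𝒱c hW hW0 hC hLV z n

/-- **Proposition 5.1 for the constructed semigroup of a uniformly confining site chain**
(`N ≥ 1`, `T_L, T_R ≥ 0`): a proper `𝒱 ∈ C²`, `𝒱 ≥ 0` with `L𝒱 ≤ C - W` (`W ≥ 0` continuous with
compact sublevel sets, `C ≥ 0`) yields an invariant probability measure `μ` of `hP.semigroup` with
`∫ W dμ ≤ 𝒱(z) + C` (Feller and Dynkin are theorems for this semigroup). [cite: HairerMattingly2009, Prop 5.1] -/
theorem exists_invariant_of_lyapunov_drift (hP : P.UniformlyConfining) (hN : 0 < N) (hTL : 0 ≤ T_L)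
    (hTR : 0 ≤ T_R) {𝒱 W : PhaseSpace N → ℝ} (h𝒱 : ContDiff ℝ 2 𝒱) (h𝒱0 : ∀ x, 0 ≤ 𝒱 x)
    (h𝒱c : ∀ R : ℝ, IsCompact {x | 𝒱 x ≤ R}) (hW : Continuous W) (hW0 : ∀ x, 0 ≤ W x)
    (hWc : ∀ R : ℝ, IsCompact {x | W x ≤ R})
    {C : ℝ} (hC : 0 ≤ C) (hLV : ∀ x, P.generator N T_L T_R 𝒱 x ≤ C - W x) (z : PhaseSpace N) :
    ∃ μ : Measure (PhaseSpace N), IsProbabilityMeasure μ ∧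
      (hP.semigroup N T_L T_R hN hTL hTR).IsInvariant μ ∧
        ∫⁻ x, ENNReal.ofReal (W x) ∂μ ≤ ENNReal.ofReal (𝒱 z + C) :=
  (hP.semigroup N T_L T_R hN hTL hTR).siteChain_exists_invariant_of_lyapunov_drift hP hN hTL hTR
    (hP.continuous_act_semigroup N T_L T_R hN hTL hTR)
    (fun _ hf hf' t z => hP.semigroup_dynkin_two N T_L T_R hN hTL hTR hf hf' t z)
    h𝒱 h𝒱0 h𝒱c hW hW0 hWc hC hLV z

end SiteChain.UniformlyConfining

end Literature.MathematicalPhysics.KineticTheory.HeatConduction
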